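import Literature.AlgebraicGeometry.HodgeTheory.WeilTypeIIGenericFibreOfPeriodSurjective
import Literature.AlgebraicGeometry.HodgeTheory.HodgeEndomorphismsHOneOfRiemann
import Literature.AlgebraicGeometry.HodgeTheory.HodgeFiltrationModelsReductionProofs
import Literature.AlgebraicGeometry.HodgeTheory.ComplexConjugationHolds
import Mathlib.Algebra.QuaternionBasis
import HarnessLib

/-!
# `End⁰(Y_s) ≅ (-d, -u)_ℚ`: the endomorphism ALGEBRA of the generic type-II fibre is the quaternion algebra `D_δ`

Family `hodge`, layer `Literature/AlgebraicGeometry/HodgeTheory`; THEOREMS ONLY (no definition, no named fact, no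
`sorry`; D-0026). Sequel to `HodgeTheory/WeilTypeIIGenericFibreOfPeriodSurjective`, which produces, in every
[U]-period-surjective family of abelian `2n`-folds (`n` odd) through a Weil-type member of discriminant class `[u]`,
`u < 0`, a fibre `Y_s` with `ψ ∈ End(Y_s)`, `Ψ_s ψ = -ψ Ψ_s`, `ψ² = c = r²(-u)`, such that EVERY endomorphism of `Y_s`
acts on `H¹(Y_s; ℚ)` through `ℚ⟨Ψ_s^*, ψ^*⟩`. Here that cohomological statement is upgraded to the ENDOMORPHISM
ALGEBRA itself, using the tree's Riemann identification `End⁰(Y)ᵐᵒᵖ ≃ₐ End_Hdg(H¹(Y(ℂ); ℚ))`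
(`endAlgebraOpAlgEquivEndAlg`, now unconditional: `exists_isReal_hodgeModel_holds`,
`hodgePQ_independent_of_hodgeModel_holds`):

* `AbelianVariety.nonempty_endAlgebra_algEquiv_quaternionAlgebra` — for a complex abelian variety `Y ≠ 0` with
  `Ψ² = -d`, `ψ² = c` (`d, c ≥ 1`), `Ψψ = -ψΨ`, such that every `φ^*|_{H¹}` lies in `ℚ1 + ℚΨ^* + ℚψ^* + ℚΨ^*ψ^*`:
  **`End⁰(Y) ≃ₐ[ℚ] ℍ[ℚ, -d, c]`** (the quaternionic basis `Ψ^*, ψ^*` of `End_ℚ H¹` lifts to an INJECTIVE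
  `ℍ[ℚ,-d,c] → End_ℚ H¹` — elementary: `aXa⁻¹`-type manipulations and `(p/q)² ≠ -d` — whose range is `End_Hdg(H¹)` by
  Riemann; `ℍ ≅ ℍᵐᵒᵖ` by quaternion conjugation);
* `QuaternionAlgebra.nonempty_algEquiv_of_sq_mul` — `ℍ[ℚ, a, r²b] ≃ₐ[ℚ] ℍ[ℚ, a, b]` (`j ↦ r j`);
* `exists_typeII_generic_endomorphismAlgebra_of_periodSurjective` — in the setting of
  `exists_typeII_generic_endomorphism_of_periodSurjective` (plus `Ψ_s² = -d` fibrewise, clause (2) of J1):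
  some fibre has **`End⁰(Y_s) ≃ₐ[ℚ] ℍ[ℚ, -d, -u] = D_{[u]}`**, the quaternion algebra OF THE CELL;
* `exists_typeII_generic_fibre_endomorphismAlgebra_of_periodConstructionAtWeilType` — the same inside Deligne's
  family through every odd-`n` Weil-type `(P, ψ₀, h_K)` of class `[u]`, `u < 0`, MODULO the named fact J1.

For sixfolds (`n = 3`, `K = ℚ(√-d)`, `δ = [δ₀]`, `δ₀ < 0`): modulo J1 alone, every non-split cell of the right sign
contains, as a fibre of Deligne's family through any of its members, an abelian sixfold with endomorphism algebra
EXACTLY `D_δ = (-d, -δ₀)_ℚ` — Shimura's generic member of the type-II family [Shimura1963AnalyticFamilies, §4],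
in the cell (vhodge ROUTE-P3-g17 §3 (b)(c): «the generic member, `End⁰ = D_δ`»).

HONEST REMARKS. J1 / [U] is a HYPOTHESIS; nothing here proves a case of the Hodge conjecture; NOT addressed: whether
`D_δ` is a division algebra (⇔ `Y_s` simple), the Néron–Severi group, Weil or Hodge classes of `Y_s`.

## References

* [Shimura1963AnalyticFamilies] G. Shimura, Ann. of Math. 78 (1963) 149–192, §4 (Type II).
* [Lange2023AbelianVarietiesComplex] H. Lange, *Abelian Varieties over the Complex Numbers* (2023), Prop. 1.1.6,
  Prop. 1.1.8 (faithful rational representation), Thm. 2.1.13 (Riemann).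
* [DeligneMilne1982Tannakian] P. Deligne, J. S. Milne, LNM 900 (1982), §6 Thm. 6.20.
* [vanGeemenVerra2003QuaternionicPryms] B. van Geemen, A. Verra, Topology 42 (2003), Lemma 4.5.
* [Deligne1982HodgeCycles] P. Deligne, LNM 900 (1982), §4, proof of Thm. 4.8.
* [vanGeemen1994HodgeAV] B. van Geemen, LNM 1594 (1994), 5.5–5.8, proof of Thm. 6.11.
-/

noncomputable section

open CategoryTheory AlgebraicGeometry Module
open scoped TensorProduct Quaternion
open Literature.AlgebraicTopology.SingularHomology
open Literature.AlgebraicGeometry Literature.AlgebraicGeometry.Motives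
open Literature.AlgebraicGeometry.ComplexMultiplication
open Literature.AlgebraicGeometry.Motives.HodgeStructure
open Literature.AlgebraicGeometry.VanGeemen1994

namespace Literature.AlgebraicGeometry.HodgeTheory

/-! ## §0 Rescaling the second parameter of a quaternion algebra by a square -/

/-- `ℍ[ℚ, a, r²b] ≃ₐ[ℚ] ℍ[ℚ, a, b]` for `r ≠ 0` (`i ↦ i`, `j ↦ r·j`): the isomorphism class of `(a, b)_F` depends on
`b` only modulo squares. [cite: vanGeemenVerra2003QuaternionicPryms, §4 (the class δ ∈ ℚ^*/Nm(K^*))] -/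
theorem QuaternionAlgebra.nonempty_algEquiv_of_sq_mul {F : Type*} [Field F] (a b r : F) (hr : r ≠ 0) :
    Nonempty (ℍ[F,a,r ^ 2 * b] ≃ₐ[F] ℍ[F,a,b]) := by
  let q0 : QuaternionAlgebra.Basis ℍ[F,a,b] a 0 b := QuaternionAlgebra.Basis.self F
  let qB : QuaternionAlgebra.Basis ℍ[F,a,b] a 0 (r ^ 2 * b) :=
    { i := q0.i
      j := r • q0.j
      k := r • q0.k
      i_mul_i := q0.i_mul_i
      j_mul_j := by
        rw [smul_mul_smul_comm, q0.j_mul_j, smul_smul, sq]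
      i_mul_j := by rw [mul_smul_comm, q0.i_mul_j]
      j_mul_i := by rw [smul_mul_assoc, q0.j_mul_i, zero_smul, zero_sub, zero_smul, zero_sub, smul_neg] }
  let q1 : QuaternionAlgebra.Basis ℍ[F,a,r ^ 2 * b] a 0 (r ^ 2 * b) := QuaternionAlgebra.Basis.self F
  let qC : QuaternionAlgebra.Basis ℍ[F,a,r ^ 2 * b] a 0 b :=
    { i := q1.i
      j := r⁻¹ • q1.j
      k := r⁻¹ • q1.k
      i_mul_i := q1.i_mul_i
      j_mul_j := by
        rw [smul_mul_smul_comm, q1.j_mul_j, smul_smul]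
        congr 1
        field_simp
      i_mul_j := by rw [mul_smul_comm, q1.i_mul_j]
      j_mul_i := by rw [smul_mul_assoc, q1.j_mul_i, zero_smul, zero_sub, zero_smul, zero_sub, smul_neg] }
  refine ⟨AlgEquiv.ofAlgHom qB.liftHom qC.liftHom ?_ ?_⟩
  · ext : 1
    · change qB.liftHom (qC.liftHom q0.i) = q0.i
      simp [QuaternionAlgebra.Basis.liftHom_apply, QuaternionAlgebra.Basis.lift, qB, qC, q0, q1,
        QuaternionAlgebra.Basis.self]
    · change qB.liftHom (qC.liftHom q0.j) = q0.j
      simp [QuaternionAlgebra.Basis.liftHom_apply, QuaternionAlgebra.Basis.lift, qB, qC, q0, q1,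
        QuaternionAlgebra.Basis.self, hr]
  · ext : 1
    · change qC.liftHom (qB.liftHom q1.i) = q1.i
      simp [QuaternionAlgebra.Basis.liftHom_apply, QuaternionAlgebra.Basis.lift, qB, qC, q0, q1,
        QuaternionAlgebra.Basis.self]
    · change qC.liftHom (qB.liftHom q1.j) = q1.j
      simp [QuaternionAlgebra.Basis.liftHom_apply, QuaternionAlgebra.Basis.lift, qB, qC, q0, q1,
        QuaternionAlgebra.Basis.self, hr]

/-! ## §1 `End⁰(Y) ≅ (-d, c)_ℚ` from the cohomological genericity statement (Riemann) -/

section EndAlgebra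

variable {Y : AbelianVariety ℂ}

/-- **`End⁰(Y) ≃ₐ[ℚ] ℍ[ℚ, -d, c]` for a GENERIC quaternionic abelian variety.** Let `Y ≠ 0` be a complex abelian
variety with endomorphisms `Ψ`, `ψ`, `Ψ² = -d`, `ψ² = c` (`d, c ≥ 1`), `Ψψ = -ψΨ`, such that every endomorphism `φ`
acts on `H¹(Y(ℂ); ℚ)` as `c₀ + c₁Ψ^* + c₂ψ^* + c₃Ψ^*ψ^*`, `cᵢ ∈ ℚ`. Then the endomorphism algebra
`End⁰(Y) = End(Y) ⊗ ℚ` is isomorphic to the quaternion algebra `(-d, c)_ℚ`: the quaternionic basis `Ψ^*, ψ^*` of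
`End_ℚ H¹` lifts to an injective `ℍ[ℚ,-d,c] →ₐ End_ℚ H¹` whose range is, by the hypothesis and Riemann's theorem
(`mem_endAlg_hodge_one_iff_exists_bettiRep`), exactly `End_Hdg(H¹) ≅ End⁰(Y)ᵐᵒᵖ` (`endAlgebraOpAlgEquivEndAlg`), and
`ℍ ≅ ℍᵐᵒᵖ` by conjugation. [cite: Lange2023AbelianVarietiesComplex, Prop. 1.1.8 and Thm. 2.1.13]
[cite: DeligneMilne1982Tannakian, §6 Thm. 6.20] [cite: Shimura1963AnalyticFamilies, §4 (Type II)] -/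
theorem AbelianVariety.nonempty_endAlgebra_algEquiv_quaternionAlgebra (hY : 0 < Y.dim) {d c : ℕ} (hd : 0 < d)
    (hc : 0 < c) {Ψ ψ : Y ⟶ Y} (hΨ : Ψ ≫ Ψ = -(d • 𝟙 Y)) (hψ : ψ ≫ ψ = c • 𝟙 Y) (hanti : Ψ ≫ ψ = -(ψ ≫ Ψ))
    (hgen : ∀ φ : Y ⟶ Y, ∃ c₀ c₁ c₂ c₃ : ℚ, ∀ x : bettiCohomology Y.X 1,
      bettiCohomology.map φ.hom.hom.hom 1 x =
        c₀ • x + c₁ • bettiCohomology.map Ψ.hom.hom.hom 1 x + c₂ • bettiCohomology.map ψ.hom.hom.hom 1 x +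
          c₃ • bettiCohomology.map Ψ.hom.hom.hom 1 (bettiCohomology.map ψ.hom.hom.hom 1 x)) :
    Nonempty (Y.endAlgebra ≃ₐ[ℚ] ℍ[ℚ,-(d : ℚ),(c : ℚ)]) := by
  classical
  haveI : Nontrivial (bettiCohomology Y.X 1) :=
    Module.nontrivial_of_finrank_pos (R := ℚ) (by rw [finrank_bettiCohomology_one]; omega)
  -- the two generators of `End_ℚ H¹` and their relations
  let a : Module.End ℚ (bettiCohomology Y.X 1) := (bettiCohomology.map Ψ.hom.hom.hom 1).hom
  let b : Module.End ℚ (bettiCohomology Y.X 1) := (bettiCohomology.map ψ.hom.hom.hom 1).hom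
  have ha : ∀ x, a x = bettiCohomology.map Ψ.hom.hom.hom 1 x := fun _ => rfl
  have hb : ∀ x, b x = bettiCohomology.map ψ.hom.hom.hom 1 x := fun _ => rfl
  have haa : a * a = (-(d : ℚ)) • (1 : Module.End ℚ (bettiCohomology Y.X 1)) := LinearMap.ext fun x => by
    rw [Module.End.mul_apply, LinearMap.smul_apply, Module.End.one_apply, ha, ha,
      bettiMap_bettiMap_of_comp_self hΨ, neg_smul]
  have hbb : b * b = (c : ℚ) • (1 : Module.End ℚ (bettiCohomology Y.X 1)) := LinearMap.ext fun x => by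
    rw [Module.End.mul_apply, LinearMap.smul_apply, Module.End.one_apply, hb, hb, ← bettiMap_comp_apply, hψ,
      bettiMap_nsmul_id_apply]
  have hba : b * a = -(a * b) := LinearMap.ext fun x => by
    rw [Module.End.mul_apply, LinearMap.neg_apply, Module.End.mul_apply, ha, hb, ha, hb,
      ← bettiMap_comp_apply, ← bettiMap_comp_apply, hanti, bettiMap_neg_apply, neg_neg]
  -- the quaternionic basis `i ↦ Ψ^*`, `j ↦ ψ^*` and its lift `L : ℍ[ℚ,-d,c] → End_ℚ H¹`
  let qB : QuaternionAlgebra.Basis (Module.End ℚ (bettiCohomology Y.X 1)) (-(d : ℚ)) 0 (c : ℚ) :=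
    { i := a
      j := b
      k := a * b
      i_mul_i := by rw [haa, zero_smul, add_zero]
      j_mul_j := hbb
      i_mul_j := rfl
      j_mul_i := by rw [hba, zero_smul, zero_sub] }
  let L : ℍ[ℚ,-(d : ℚ),(c : ℚ)] →ₐ[ℚ] Module.End ℚ (bettiCohomology Y.X 1) := qB.liftHom
  have hL : ∀ x : ℍ[ℚ,-(d : ℚ),(c : ℚ)],
      L x = x.re • (1 : Module.End ℚ (bettiCohomology Y.X 1)) + x.imI • a + x.imJ • b + x.imK • (a * b) := by
    intro x
    simp [L, QuaternionAlgebra.Basis.liftHom_apply, QuaternionAlgebra.Basis.lift, qB, Algebra.algebraMap_eq_smul_one]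
  -- `p + qΨ^* = 0 ⟹ p = q = 0` (`(p/q)² ≠ -d`)
  have hlin : ∀ p q : ℚ, p • (1 : Module.End ℚ (bettiCohomology Y.X 1)) + q • a = 0 → p = 0 ∧ q = 0 := by
    intro p q h
    by_cases hq : q = 0
    · rw [hq, zero_smul, add_zero] at h
      exact ⟨(smul_eq_zero.1 h).resolve_right one_ne_zero, hq⟩
    · exfalso
      have ha' : a = (-(p / q)) • (1 : Module.End ℚ (bettiCohomology Y.X 1)) := by
        have h' := congrArg (fun z => q⁻¹ • z) h
        simp only [smul_add, smul_smul, inv_mul_cancel₀ hq, one_smul, smul_zero] at h'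
        rw [neg_smul, eq_neg_iff_add_eq_zero, div_eq_inv_mul, ← h', add_comm]
      have h2 : a * a = ((p / q) ^ 2) • (1 : Module.End ℚ (bettiCohomology Y.X 1)) := by
        rw [ha', smul_mul_smul_comm, one_mul, neg_mul_neg, sq]
      have h3 : ((p / q) ^ 2 + d : ℚ) • (1 : Module.End ℚ (bettiCohomology Y.X 1)) = 0 := by
        rw [add_smul, ← h2, haa, ← add_smul, neg_add_cancel, zero_smul]
      have h4 : (p / q) ^ 2 + (d : ℚ) = 0 := (smul_eq_zero.1 h3).resolve_right one_ne_zero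
      nlinarith [sq_nonneg (p / q), (show (0 : ℚ) < d by exact_mod_cast hd)]
  -- `L` is injective
  have hinj : Function.Injective L := by
    rw [injective_iff_map_eq_zero]
    intro x hx
    rw [hL] at hx
    -- `Ψ^* X` and `X Ψ^*`, reduced with the relations
    have h1 : a * (x.re • (1 : Module.End ℚ (bettiCohomology Y.X 1)) + x.imI • a + x.imJ • b + x.imK • (a * b)) =
        x.re • a + (x.imI * -(d : ℚ)) • 1 + x.imJ • (a * b) + (x.imK * -(d : ℚ)) • b := by
      rw [mul_add, mul_add, mul_add, mul_smul_comm, mul_smul_comm, mul_smul_comm, mul_smul_comm, mul_one,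
        ← mul_assoc a a b, haa, smul_mul_assoc, one_mul, smul_smul, smul_smul]
    have h2 : (x.re • (1 : Module.End ℚ (bettiCohomology Y.X 1)) + x.imI • a + x.imJ • b + x.imK • (a * b)) * a =
        x.re • a + (x.imI * -(d : ℚ)) • 1 - x.imJ • (a * b) - (x.imK * -(d : ℚ)) • b := by
      rw [add_mul, add_mul, add_mul, smul_mul_assoc, smul_mul_assoc, smul_mul_assoc, smul_mul_assoc, one_mul,
        haa, hba, mul_assoc a b a, hba, mul_neg, ← mul_assoc a a b, haa, smul_mul_assoc, one_mul, smul_neg,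
        smul_neg, smul_smul, smul_smul, sub_eq_add_neg, sub_eq_add_neg]
    rw [hx, mul_zero] at h1
    rw [hx, zero_mul] at h2
    have h3 : ((2 * x.imJ) • a + (2 * x.imK * -(d : ℚ)) • (1 : Module.End ℚ (bettiCohomology Y.X 1))) * b = 0 := by
      rw [add_mul, smul_mul_assoc, smul_mul_assoc, one_mul]
      linear_combination (norm := module) h2 - h1
    have h4 : (2 * (x.imK * -(d : ℚ))) • (1 : Module.End ℚ (bettiCohomology Y.X 1)) + (2 * x.imJ) • a = 0 := by
      have h5 := congrArg (· * b) h3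
      simp only [zero_mul, mul_assoc, hbb, mul_smul_comm, mul_one] at h5
      rw [add_comm]
      exact (smul_eq_zero.1 h5).resolve_left (by exact_mod_cast hc.ne')
    obtain ⟨hK, hJ⟩ := hlin _ _ h4
    have hJ' : x.imJ = 0 := by linarith
    have hK' : x.imK = 0 := by
      have hd' : (d : ℚ) ≠ 0 := by exact_mod_cast hd.ne'
      have : 2 * x.imK * (d : ℚ) = 0 := by linarith
      simpa [hd'] using this
    rw [hJ', hK', zero_smul, zero_smul, add_zero, add_zero] at hx
    obtain ⟨hR, hI⟩ := hlin _ _ hx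
    exact QuaternionAlgebra.ext hR hI hJ' hK'
  -- Riemann: the range of `L` is `End_Hdg(H¹) ≅ End⁰(Y)ᵐᵒᵖ`
  have hHD : exists_isReal_hodgeModel := exists_isReal_hodgeModel_holds
  have hI : hodgePQ_independent_of_hodgeModel := hodgePQ_independent_of_hodgeModel_holds
  have haS : a ∈ (BettiUniverse.hodge hHD (AbelianVariety.isSmoothProjective_holds (A := Y)) 1).endAlg := by
    have h := unop_bettiRep_mem_endAlg hHD hI (AbelianVariety.endAlgebra.of Y Ψ)
    rwa [bettiRep_of, MulOpposite.unop_op] at h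
  have hbS : b ∈ (BettiUniverse.hodge hHD (AbelianVariety.isSmoothProjective_holds (A := Y)) 1).endAlg := by
    have h := unop_bettiRep_mem_endAlg hHD hI (AbelianVariety.endAlgebra.of Y ψ)
    rwa [bettiRep_of, MulOpposite.unop_op] at h
  have hrange : L.range = (BettiUniverse.hodge hHD (AbelianVariety.isSmoothProjective_holds (A := Y)) 1).endAlg := by
    refine le_antisymm ?_ fun y hy => ?_
    · rintro _ ⟨x, rfl⟩
      change L x ∈ _
      rw [hL]
      refine add_mem (add_mem (add_mem (Subalgebra.smul_mem _ (Subalgebra.one_mem _) _)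
        (Subalgebra.smul_mem _ haS _)) (Subalgebra.smul_mem _ hbS _)) (Subalgebra.smul_mem _ (Subalgebra.mul_mem _ haS hbS) _)
    · obtain ⟨e, he⟩ := (mem_endAlg_hodge_one_iff_exists_bettiRep hHD hI y).1 hy
      obtain ⟨q, F, hF⟩ := exists_unop_bettiRep_eq_smul_pull e
      rw [← he, hF]
      refine Subalgebra.smul_mem _ ?_ q
      obtain ⟨c₀, c₁, c₂, c₃, hφ⟩ := hgen F
      refine ⟨⟨c₀, c₁, c₂, c₃⟩, ?_⟩
      change L _ = _
      rw [hL]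
      refine LinearMap.ext fun x => ?_
      rw [LinearMap.add_apply, LinearMap.add_apply, LinearMap.add_apply, LinearMap.smul_apply, LinearMap.smul_apply,
        LinearMap.smul_apply, LinearMap.smul_apply, Module.End.one_apply, Module.End.mul_apply, ha, hb, ha]
      exact (hφ x).symm
  have e : Y.endAlgebraᵐᵒᵖ ≃ₐ[ℚ] ℍ[ℚ,-(d : ℚ),(c : ℚ)] :=
    (endAlgebraOpAlgEquivEndAlg (B := Y) hHD hI).trans
      ((Subalgebra.equivOfEq _ _ hrange.symm).trans (AlgEquiv.ofInjective L hinj).symm)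
  exact ⟨(AlgEquiv.opComm.symm e).trans (QuaternionAlgebra.starAe).symm⟩

end EndAlgebra

/-! ## §2 The generic type-II fibre has `End⁰ ≅ D_δ` -/

section TypeII

variable {n d : ℕ}

/-- **THE GENERIC TYPE-II FIBRE HAS ENDOMORPHISM ALGEBRA `D_{[u]} = (-d, -u)_ℚ`.** In the setting of
`exists_typeII_generic_endomorphism_of_periodSurjective` — an abelian `2n`-fold `(P, ψ₀, h_K)` of Weil type `(n, n)`,
`n` odd, with a non-degenerate discriminant witness of class `[u]`, `u < 0`, and any family `(Y_s, Ψ_s)` of abelian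
`2n`-folds with `Ψ_s² = -d` satisfying [U] — some fibre `Y_s` carries `ψ` with `Ψ_s ψ = -ψ Ψ_s`, `ψ² = c·𝟙`,
`c = r²(-u) > 0`, AND `End⁰(Y_s) = End(Y_s) ⊗ ℚ ≃ₐ[ℚ] ℍ[ℚ, -d, -u]`: the quaternion algebra `D_{[u]}` of the
cell, realised as the full endomorphism algebra of a fibre (Riemann + the cohomological genericity + `(-d, r²(-u))_ℚ ≅
(-d, -u)_ℚ`). [cite: Shimura1963AnalyticFamilies, §4 (Type II: the generic member has endomorphism algebra D)]
[cite: vanGeemen1994HodgeAV, 5.5–5.8 and proof of Thm. 6.11] [cite: Lange2023AbelianVarietiesComplex, Prop. 1.1.8 and Thm. 2.1.13]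
[cite: Deligne1982HodgeCycles, proof of Thm. 4.8 (the family B → X⁺; Milne's TeXed ed. p. 34)] -/
theorem exists_typeII_generic_endomorphismAlgebra_of_periodSurjective (hodd : Odd n)
    {P : AbelianVariety ℂ} (hP : P.dim = 2 * n) {ψ₀ : P ⟶ P}
    (e : ProjectiveEmbedding P.X) {a : complexBetti (projectiveSpace e.n ℂ) 2}
    (ha : IsRationalClass a) (ha0 : a ≠ 0)
    (hweilP : ∃ c ∈ weilClassesOf P ψ₀ n d, c ≠ 0 ∧ IsOfHodgeType (2 * n) P.X (2 * n) n n c)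
    (u : ℚˣ) (hu : (u : ℚ) < 0)
    (hδP : HasWeilDiscriminantNondeg P ψ₀ n d
      ((d : ℂ) • complexBetti.map e.ι 2 a + complexBetti.map ψ₀.hom.hom.hom 2 (complexBetti.map e.ι 2 a))
      (QuotientGroup.mk u))
    {S : Type*} (Y : S → AbelianVariety ℂ) (Ψ : ∀ s, Y s ⟶ Y s) (hY : ∀ s, (Y s).dim = 2 * n)
    (hΨ : ∀ s, Ψ s ≫ Ψ s = -(d • 𝟙 (Y s)))
    (hU : ∃ (m : ℕ) (hm : 1 ≤ m) (hPm : P.dim = m + 1) (hd : 0 < d) (hψ : ψ₀ ≫ ψ₀ = -(d • 𝟙 P))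
        (ω : complexBetti P.X (2 + 2 * m)) (hω : IsRationalClass ω) (hω0 : ω ≠ 0),
        ∀ (J : (weilDatumOfKsymm hm hPm hd hψ e ha ha0 hω hω0).Cx →ₗ[ℂ]
            (weilDatumOfKsymm hm hPm hd hψ e ha ha0 hω hω0).Cx)
          (hW : IsWeilComplexStructure (weilDatumOfKsymm hm hPm hd hψ e ha ha0 hω hω0).hForm J),
          ∃ (s : S) (β : bettiCohomology P.X 1 ≃ₗ[ℚ] bettiCohomology (Y s).X 1),
            (∀ x, β (bettiCohomology.map ψ₀.hom.hom.hom 1 x) = bettiCohomology.map (Ψ s).hom.hom.hom 1 (β x)) ∧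
            ∀ x ∈ ((weilDatumOfKsymm hm hPm hd hψ e ha ha0 hω hω0).hodgeStructure J hW.sq).piece 1 0,
              IsOfHodgeType (2 * n) (Y s).X 1 1 0
                (Motives.ofRatClassBaseChange (ComplexPoints (Y s).X) 1 (β.toLinearMap.baseChange ℂ x))) :
    ∃ (s : S) (ψ : Y s ⟶ Y s) (c : ℕ), 0 < c ∧ Ψ s ≫ ψ = -(ψ ≫ Ψ s) ∧ ψ ≫ ψ = c • 𝟙 (Y s) ∧
      (∃ r : ℚ, r ≠ 0 ∧ (c : ℚ) = r ^ 2 * (-(u : ℚ))) ∧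
      Nonempty ((Y s).endAlgebra ≃ₐ[ℚ] ℍ[ℚ,-(d : ℚ),-(u : ℚ)]) := by
  obtain ⟨m, hm, hPm, hd, hrest⟩ := hU
  obtain ⟨s, ψ, c, hc, hanti, hsq, ⟨r, hr, hcr⟩, hgen⟩ :=
    exists_typeII_generic_endomorphism_of_periodSurjective hodd hP e ha ha0 hweilP u hu hδP Y Ψ hY
      ⟨m, hm, hPm, hd, hrest⟩
  have hn : 0 < n := by
    obtain ⟨k, hk⟩ := hodd
    omega
  have hYs : 0 < (Y s).dim := by rw [hY s]; omega
  obtain ⟨e₁⟩ := AbelianVariety.nonempty_endAlgebra_algEquiv_quaternionAlgebra hYs hd hc (hΨ s) hsq hanti hgen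
  obtain ⟨e₂⟩ := QuaternionAlgebra.nonempty_algEquiv_of_sq_mul (-(d : ℚ)) (-(u : ℚ)) r hr
  refine ⟨s, ψ, c, hc, hanti, hsq, ⟨r, hr, hcr⟩, ⟨e₁.trans ?_⟩⟩
  rw [hcr]
  exact e₂

/-- **DELIGNE'S FAMILY HAS A FIBRE WITH `End⁰ ≅ D_δ`, MODULO J1.** Granted Deligne's period construction
(`deligne1982_weilFamily_periodConstructionAtWeilType`, the NAMED FACT «J1», a HYPOTHESIS here): for every abelian
`2n`-fold `(P, ψ₀, h_K)` OF WEIL TYPE `(n, n)`, `n` ODD, `d ≥ 1`, whose `K`-symmetrised hyperplane class has a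
non-degenerate discriminant witness of class `[u]`, `u < 0`, Deligne's smooth projective family `f : 𝒳 → S` through
`P = 𝒳_{s₀}` (clauses (1), (2), (6) re-exported) has a fibre `Y_s` carrying `ψ` (`Ψ_s ψ = -ψ Ψ_s`, `ψ² = r²(-u)·𝟙 > 0`)
with **`End⁰(Y_s) ≃ₐ[ℚ] ℍ[ℚ, -d, -u]`** — for sixfolds: every non-split cell `(3, K_d, [δ₀])`, `δ₀ < 0`, contains,
modulo J1 alone, a fibre of Deligne's family through any of its members whose endomorphism algebra is EXACTLY
`D_δ = (-d, -δ₀)_ℚ` (the GENERIC type-II member in the cell). `exists_typeII_generic_endomorphismAlgebra_of_periodSurjective`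
fed with clause (5U). NOT here: simplicity of `Y_s` (whether `D_δ` is a division algebra).
[cite: Deligne1982HodgeCycles, §4 Prop. 4.4 and proof of Thm. 4.8 (Milne's TeXed ed. pp. 32–34)]
[cite: vanGeemen1994HodgeAV, 4.9, 5.3–5.8 and proof of Thm. 6.11] [cite: Shimura1963AnalyticFamilies, §4 (Type II)]
[cite: Lange2023AbelianVarietiesComplex, Prop. 1.1.8 and Thm. 2.1.13] -/
theorem exists_typeII_generic_fibre_endomorphismAlgebra_of_periodConstructionAtWeilType
    (hJ : deligne1982_weilFamily_periodConstructionAtWeilType) (hodd : Odd n) (hd : 1 ≤ d)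
    {P : AbelianVariety ℂ} {ψ₀ : P ⟶ P} (hWT : IsWeilType P ψ₀ n d)
    (e : ProjectiveEmbedding P.X) {a : complexBetti (projectiveSpace e.n ℂ) 2}
    (ha : IsRationalClass a) (ha0 : a ≠ 0) (u : ℚˣ) (hu : (u : ℚ) < 0)
    (hδP : HasWeilDiscriminantNondeg P ψ₀ n d
      ((d : ℂ) • complexBetti.map e.ι 2 a + complexBetti.map ψ₀.hom.hom.hom 2 (complexBetti.map e.ι 2 a))
      (QuotientGroup.mk u)) :
    ∃ (𝒳 S : SchemeOver ℂ) (f : 𝒳 ⟶ S) (g : 𝒳 ⟶ 𝒳) (s₀ : ComplexPoints S)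
      (e' : P.X ≅ fiberOver f s₀)
      (Y : ComplexPoints S → AbelianVariety ℂ) (Ψ : ∀ s, Y s ⟶ Y s)
      (ε : ∀ s, (Y s).X ≅ fiberOver f s) (N : ℕ)
      (ι : 𝒳 ⟶ CategoryTheory.MonoidalCategoryStruct.tensorObj (projectiveSpace N ℂ) S)
      (a' : complexBetti (projectiveSpace N ℂ) 2),
      IsSmoothProjectiveFamily f (2 * n) ∧
      AlgebraicGeometry.IsClosedImmersion ι.left ∧
      ι ≫ CategoryTheory.CartesianMonoidalCategory.snd (projectiveSpace N ℂ) S = f ∧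
      IrreducibleSpace S.left ∧ AlgebraicGeometry.Smooth S.hom ∧ IsQuasiProjectiveOver S ∧
      g ≫ f = f ∧
      (e'.hom ≫ fiberι f s₀) ≫ g = ψ₀.hom.hom.hom ≫ (e'.hom ≫ fiberι f s₀) ∧
      (∀ s, (Y s).dim = 2 * n ∧ Ψ s ≫ Ψ s = -((d : ℤ) • 𝟙 (Y s)) ∧
        ((ε s).hom ≫ fiberι f s) ≫ g = (Ψ s).hom.hom.hom ≫ ((ε s).hom ≫ fiberι f s)) ∧
      IsRationalClass a' ∧
      complexBetti.map e'.hom 2 (complexBetti.map (fiberι f s₀) 2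
        (complexBetti.map
          (ι ≫ CategoryTheory.CartesianMonoidalCategory.fst (projectiveSpace N ℂ) S) 2 a')) =
        (d : ℂ) • complexBetti.map e.ι 2 a +
          complexBetti.map ψ₀.hom.hom.hom 2 (complexBetti.map e.ι 2 a) ∧
      ∃ (s : ComplexPoints S) (ψ : Y s ⟶ Y s) (c : ℕ), 0 < c ∧ Ψ s ≫ ψ = -(ψ ≫ Ψ s) ∧
        ψ ≫ ψ = c • 𝟙 (Y s) ∧ (∃ r : ℚ, r ≠ 0 ∧ (c : ℚ) = r ^ 2 * (-(u : ℚ))) ∧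
        Nonempty ((Y s).endAlgebra ≃ₐ[ℚ] ℍ[ℚ,-(d : ℚ),-(u : ℚ)]) := by
  have hn : 1 ≤ n := hodd.pos
  have hP : P.dim = 2 * n := hWT.dim_eq
  have hψZ : ψ₀ ≫ ψ₀ = -((d : ℤ) • 𝟙 P) := by rw [natCast_zsmul]; exact hWT.sq_eq
  -- a non-zero Weil class of type `(n, n)` (the Weil plane is a plane; van Geemen 4.10 / 5.2 (5)–(6))
  have hweilP : ∃ c ∈ weilClassesOf P ψ₀ n d, c ≠ 0 ∧ IsOfHodgeType (2 * n) P.X (2 * n) n n c := by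
    have h2 := hWT.finrank_weilClassesOf
    have hne : weilClassesOf P ψ₀ n d ≠ ⊥ := by
      intro h
      rw [h, finrank_bot] at h2
      exact two_ne_zero h2.symm
    obtain ⟨c, hc, hc0⟩ := (Submodule.ne_bot_iff _).1 hne
    exact ⟨c, hc, hc0, hWT.isOfHodgeType_of_mem_weilClassesOf hc⟩
  obtain ⟨𝒳, S, f, g, s₀, e', Y, Ψ, ε, N, ι, a', hfam, hιcl, hιf, hirr, hsm, hqp, hgf, hge', hY, -, hU, ha'r,
    ha'pol⟩ := hJ n d hn hd P ψ₀ e a hP hψZ ha ha0 hWT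
  obtain ⟨s, ψ, c, hc, hanti, hsq, hr, hEnd⟩ := exists_typeII_generic_endomorphismAlgebra_of_periodSurjective hodd
    hP e ha ha0 hweilP u hu hδP Y Ψ (fun s => (hY s).1) (fun s => by rw [(hY s).2.1, natCast_zsmul]) hU
  exact ⟨𝒳, S, f, g, s₀, e', Y, Ψ, ε, N, ι, a', hfam, hιcl, hιf, hirr, hsm, hqp, hgf, hge', hY, ha'r, ha'pol,
    s, ψ, c, hc, hanti, hsq, hr, hEnd⟩

end TypeII

end Literature.AlgebraicGeometry.HodgeTheory

end
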